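import Literature.NumberTheory.GaloisRepresentations.WildInertia
import Literature.NumberTheory.GaloisRepresentations.ModPGaloisRepProofs
import Literature.NumberTheory.GaloisRepresentations.RamificationFiltrationProofs
import Literature.NumberTheory.GaloisRepresentations.SerreWeightExistenceProofs
import Literature.NumberTheory.GaloisRepresentations.FrobeniusOnTameInertiaImage
import Literature.NumberTheory.GaloisRepresentations.LocalGaloisGroupFrobeniusProofs
import Literature.NumberTheory.GaloisRepresentations.AbsGaloisGroup
import Literature.AnabelianGeometry.AbsoluteAnabelian.MLFGaloisStronglyCompleteReduction
import Mathlib.Topology.Algebra.OpenSubgroup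
import HarnessLib

/-!
# The wild inertia group inside `Γ_F`: closedness, `I_F^v ⊆ P_F`, and the tame structure at
# finite levels

`F` a non-archimedean local field, `Γ_F = Gal(F̄/F)`, `I_F = absInertia F`, `P_F = absWildInertia F ϖ`
(`ϖ` a uniformiser), `p` the residue characteristic, `q = #𝓀[F]`.  This file records, in the shape
consumed by the group-theoretic files `Literature/GroupTheory/ProP/NormalGeneratorsProfinite.lean`
and `OperatorFrattiniOpen.lean`, the classical structure of `Γ_F / P_F` (Serre, *Local Fields*,
Ch. IV §2; Neukirch–Schmidt–Wingberg, Thm. 7.5.3: `Γ_F / P_F` is topologically generated by a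
Frobenius `σ` and a generator `τ` of tame inertia with `σ τ σ⁻¹ = τ^q`):

* (`P_F` is closed: `MLFGaloisTameStronglyComplete.isClosed_absWildInertia`, abc-iut-w5-d200;)
* `absUpperInertia_le_absWildInertia` — `I_F^v ⊆ P_F` for `v > 0` (characteristic `0`): the Kummer
  characters `θ_d`, `p ∤ d`, kill `I_F^v` (`kummerCharacter_apply_eq_one_of_mem_absUpperInertia`) and
  `P_F` is their common kernel (`mem_absWildInertia_of_kummerCharacterQuot_eq_one`);
* `isCyclic_map_absInertia_of_absWildInertia_le` — in every finite continuous quotient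
  `Γ_F ⧸ U` with `P_F ≤ U` the image of `I_F` is cyclic of order prime to `p`
  (`absInertia_map_isCyclic_holds`, Serre IV §2 Cor. 1 of Prop. 7);
* `exists_frob_mk_eq_zpow_mul` — every finite continuous quotient of `Γ_F` is `⟨φ̄⟩ · Ī_F` for an
  arithmetic Frobenius `φ` (`exists_eq_frob_zpow_mul_of_isOpen_ker`);
* `frob_conj_mul_pow_inv_mem_absWildInertia` — `φ t φ⁻¹ t^{-q} ∈ P_F` for `t ∈ I_F`
  (`conj_mul_pow_inv_mem_absWildInertia`).

Proof-only (no definitions); assembles tree facts. [cite: SerreLocalFields1979, Ch. IV §2 Cor. 1 and Cor. 3 of Prop. 7]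
[cite: NeukirchSchmidtWingberg2008, Thm. 7.5.3]
-/

noncomputable section

open scoped Pointwise Valued
open Field ValuativeRel

namespace Literature.NumberTheory.GaloisRepresentations

open GaloisRepresentations.IsNonarchimedeanLocalField

universe u

variable (F : Type u) [Field F] [ValuativeRel F] [TopologicalSpace F] [IsNonarchimedeanLocalField F]

/-! ### `I_F^v ⊆ P_F` for `v > 0` -/

/-- **The higher ramification groups lie in wild inertia**: `I_F^v ≤ P_F` for `v > 0` (in
characteristic `0`).  The Kummer characters `θ_d` (`p ∤ d`) are trivial on `I_F^v`, and `P_F` is their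
common kernel. [cite: SerreLocalFields1979, Ch. IV §2 Cor. 1 and Cor. 3 of Prop. 7]
[cite: SerreInventiones1972, §1.3] -/
theorem absUpperInertia_le_absWildInertia [CharZero F] {ϖ : 𝒪[F]} (hϖ0 : ϖ ≠ 0) {v : ℝ} (hv : 0 < v) :
    absUpperInertia F v ≤ absWildInertia F ϖ := by
  intro σ hσ
  have hσI : σ ∈ absInertia F := absUpperInertia_le_absInertia_holds F v hσ
  haveI : (absMaximalIdeal F).IsMaximal := absMaximalIdeal_isMaximal_holds F
  letI : Field (absIntegers 𝒪[F] F ⧸ absMaximalIdeal F) := Ideal.Quotient.field _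
  refine mem_absWildInertia_of_kummerCharacterQuot_eq_one hϖ0 hσI fun d hd hpd => ?_
  have hnF : ((d : ℕ) : F) ≠ 0 := Nat.cast_ne_zero.mpr hd.ne'
  have h := kummerCharacter_apply_eq_one_of_mem_absUpperInertia hd hϖ0 hnF
    (RingHom.id (absIntegers 𝒪[F] F ⧸ absMaximalIdeal F)) hv ⟨σ, hσI⟩ hσ
  have h' := congrArg (fun u : (absIntegers 𝒪[F] F ⧸ absMaximalIdeal F)ˣ =>
    (u : absIntegers 𝒪[F] F ⧸ absMaximalIdeal F)) h
  simp only [coe_kummerCharacter_apply, RingHom.id_apply, Units.val_one] at h'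
  exact h'

/-! ### The tame structure at finite levels -/

/-- **Tame inertia is pro-cyclic of order prime to `p`, at finite levels**: for every open normal
subgroup `U` of `Γ_F` containing `P_F` (`ϖ ≠ 0`, characteristic `0`), the image of `I_F` in `Γ_F ⧸ U`
is cyclic of order prime to `p`. [cite: SerreLocalFields1979, Ch. IV §2 Cor. 1 of Prop. 7] -/
theorem isCyclic_map_absInertia_of_absWildInertia_le [CharZero F] {ϖ : 𝒪[F]} (hϖ0 : ϖ ≠ 0)
    (U : OpenNormalSubgroup (absoluteGaloisGroup F)) (hU : absWildInertia F ϖ ≤ U.toSubgroup) :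
    IsCyclic ((absInertia F).map (QuotientGroup.mk' U.toSubgroup)) ∧
      (Nat.card ((absInertia F).map (QuotientGroup.mk' U.toSubgroup))).Coprime (ringChar 𝓀[F]) := by
  haveI : DiscreteTopology (absoluteGaloisGroup F ⧸ U.toSubgroup) := QuotientGroup.discreteTopology U.isOpen
  let f : absoluteGaloisGroup F →ₜ* absoluteGaloisGroup F ⧸ U.toSubgroup :=
    ⟨QuotientGroup.mk' U.toSubgroup, QuotientGroup.continuous_mk⟩
  have hkill : ∀ v : ℝ, 0 < v → ∀ σ ∈ absUpperInertia F v, f σ = 1 := by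
    intro v hv σ hσ
    change QuotientGroup.mk' U.toSubgroup σ = 1
    rw [QuotientGroup.mk'_apply, QuotientGroup.eq_one_iff]
    exact hU (absUpperInertia_le_absWildInertia F hϖ0 hv hσ)
  exact absInertia_map_isCyclic_holds F (absoluteGaloisGroup F ⧸ U.toSubgroup) f hkill

/-- **`Γ_F / I_F` is pro-cyclic on Frobenius, at finite levels**: for an arithmetic Frobenius `φ`
and every open normal subgroup `U`, every element of `Γ_F ⧸ U` is `φ̄ ^ n · ῑ` with `ι ∈ I_F`.
[cite: SerreLocalFields1979, Ch. IV §2] -/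
theorem exists_frob_mk_eq_zpow_mul {φ : absoluteGaloisGroup F} (hφ : IsAbsArithFrob φ)
    (U : OpenNormalSubgroup (absoluteGaloisGroup F)) (x : absoluteGaloisGroup F) :
    ∃ (n : ℤ) (ι : absoluteGaloisGroup F), ι ∈ absInertia F ∧
      QuotientGroup.mk' U.toSubgroup x =
        QuotientGroup.mk' U.toSubgroup φ ^ n * QuotientGroup.mk' U.toSubgroup ι := by
  have hopen : IsOpen (((QuotientGroup.mk' U.toSubgroup).ker : Subgroup (absoluteGaloisGroup F)) :
      Set (absoluteGaloisGroup F)) := by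
    rw [QuotientGroup.ker_mk']; exact U.isOpen
  exact exists_eq_frob_zpow_mul_of_isOpen_ker (QuotientGroup.mk' U.toSubgroup) hopen hφ x

/-- **Frobenius acts on tame inertia by `u ↦ u^q`**, `q = p ^ f` the residue cardinality: for an
arithmetic Frobenius `φ` and `t ∈ I_F`, `φ t φ⁻¹ t^{-q} ∈ P_F`.
[cite: SerreLocalFields1979, Ch. IV §2 Exercise 2] [cite: SerreInventiones1972, §1.8 Prop. 6] -/
theorem frob_conj_mul_pow_inv_mem_absWildInertia {ϖ : 𝒪[F]} (hϖ0 : ϖ ≠ 0)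
    {φ : absoluteGaloisGroup F} (hφ : IsAbsArithFrob φ) {t : absoluteGaloisGroup F}
    (ht : t ∈ absInertia F) :
    φ * t * φ⁻¹ * (t ^ residueFieldCard F)⁻¹ ∈ absWildInertia F ϖ := by
  have h := conj_mul_pow_inv_mem_absWildInertia hϖ0 (IsAbsArithFrob.isFrobPow_holds hφ) ht
  rwa [pow_one] at h

/-- **`P_F` is pro-`p` inside `Γ_F`** in the elementwise form consumed by the group-theoretic files:
every `x ∈ P_F` has `x ^ (p ^ a) ∈ U` for every open subgroup `U` (`ϖ` a uniformiser).
[cite: SerreLocalFields1979, Ch. IV §2 Cor. 3 of Prop. 7] -/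
theorem absWildInertia_pow_mem_of_isOpen {ϖ : 𝒪[F]} (hϖ : Irreducible ϖ) :
    ∀ x ∈ absWildInertia F ϖ, ∀ U : Subgroup (absoluteGaloisGroup F),
      IsOpen (U : Set (absoluteGaloisGroup F)) → ∃ a : ℕ, x ^ (ringChar 𝓀[F] ^ a) ∈ U :=
  fun _ hx U hU => absWildInertia_isProP_holds F hϖ hx U hU

end Literature.NumberTheory.GaloisRepresentations

end
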